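import Summits.ValiantsHypothesis.ValiantsHypothesis.Theorems.FifoMatchingNNDivisionHardLocalizationUPat

/-!
# FifoMatching · NNDivisionHard — localization, part 13: §B7 `UPat` — closure under the free-face recursion and under `Hull`

Theorems-grade port (bytes staged by val-idea-43 g6 for a port hand) of the second half of §B7 of the crux workfile
`Cruxes/NNDivisionHard/Symmetry43.lean` REV 5 (val-idea-43 g6; crux `stmt-ValiantsHypothesis-21181` `FifoMatching.NNDivisionHard`) — statements
and proofs VERBATIM, namespace `…Theorems.FifoMatching.Localization` (imports part 12 `…LocalizationUPat` for `UPatAt` / `UPatF` / `UPat` /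
`uPatAt_of_hull_eq` / `quiet_le_uPatF` / `uPat_decided`; uses part 11 `Hull`, part 7 `Face` / `delRead_image_corFace` / `delRead_image_hullFace` /
`face_mono` / `loc_le_face`, part 6 `decided_autStar`, part 3 `unitEntry`).

* `liftF ι U` (a functional on the `ι`-minor lifted to `Fin h × Fin h`), `liftF_dotProduct : liftF ι U ⬝ x = U ⬝ π_ι x`;
* ★★★ `face_uPatF_le (hs : Monotone s) : Face (UPatF s) h K q → UPatF (s ∘ ⌊√·⌋) h K q` — an inner pattern of order `m` for the top sub-family
  read on a free face LIFTS to a pattern of the SAME order for the family (rows `λ•w + liftF ι (c′ a)` with ONE finite `λ`, columns lifted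
  through the face); only the floor moves, the `c ↦ 2c` exchange of `decided_face` is not paid per storey;
* BY NAME: `face_uPatF_id_le`, ★★ `faceQuiet_le_uPat : Face Quiet ≤ UPat`, `locQuiet_le_uPat`, `face_uPat_le : Face UPat ≤ UPat₄`,
  `faceFaceQuiet_le_uPat4`, `hull_uPatF_le : Hull (UPatF s) ≤ UPatF s`, `hullFaceQuiet_le_uPat`, `autStar_uPat_decided`.

Honest label: closure theorems of a genus for the TOP cone; NOT progress on `C′ = ExactPencilLaw` nor on `CoreLawFace`; 0 explicit residual
members before and after; 21181 OPEN; VP ≠ VNP NOT proved.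
-/

set_option linter.unusedVariables false
set_option linter.unusedSectionVars false
set_option linter.dupNamespace false

namespace Summit.ValiantsHypothesis.ValiantsHypothesis.Theorems.FifoMatching.Localization

open Matrix Finset
open scoped Pointwise
open Literature.Barriers.PneNP (HasEFOfSize)
open Literature.Combinatorics.Optimization (corPolytopeGraph corVec)

/-! ### ★★★ closure under the free-face recursion, without exchange -/

/-- the functional `U` on the `ι`-minor, lifted to `Fin h × Fin h` (zero elsewhere): `liftF ι U · x = U · (x read on ι)`. -/
noncomputable def liftF {ℓ h : ℕ} (ι : Fin ℓ ↪ Fin h) (U : Fin ℓ × Fin ℓ → ℝ) : Fin h × Fin h → ℝ :=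
  ∑ p : Fin ℓ × Fin ℓ, U p • unitEntry (ι p.1, ι p.2)

/-- `liftF ι U · x = U · π_ι x`. -/
theorem liftF_dotProduct {ℓ h : ℕ} (ι : Fin ℓ ↪ Fin h) (U : Fin ℓ × Fin ℓ → ℝ) (x : Fin h × Fin h → ℝ) :
    liftF ι U ⬝ᵥ x = U ⬝ᵥ delRead ι x := by
  unfold liftF
  rw [sum_dotProduct]
  simp only [smul_dotProduct, unitEntry_dotProduct, smul_eq_mul]
  unfold dotProduct
  refine sum_congr rfl fun p _ => ?_
  obtain ⟨i, j⟩ := p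
  rw [delRead_apply]

/-- ★★★ **CLOSURE UNDER `Face` WITHOUT EXCHANGE**: a pattern of order `m` for the top sub-family read on a free face LIFTS to a pattern of
the SAME order for the family itself — rows `λ•w + liftF ι (c′ a)` (`λ` large but finite: finitely many generator pairs), columns lifted
through the face (`delRead_image_corFace`, `delRead_image_hullFace`).  Only the floor moves: `Face (UPatF s) ≤ UPatF (s ∘ ⌊√·⌋)`. -/
theorem face_uPatF_le {s : ℕ → ℕ} (hs : Monotone s) {h K : ℕ} {q : Fam h K} (hq : Face (UPatF s) h K q) :
    UPatF (fun h => s (Nat.sqrt h)) h K q := by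
  classical
  obtain ⟨ℓ, hℓ, ι, w, M, hval, hfree, K', e, he₁, he₂, m, hm, c', d', x', hval', hx', htight', hdisj'⟩ := hq
  refine ⟨m, (hs hℓ).trans hm, ?_⟩
  set t₀ : ℝ := w ⬝ᵥ q (e 0) with ht₀
  -- (1) lift the columns through the face
  have hxlift : ∀ b, ∃ X : Fin h × Fin h → ℝ, X ∈ corPolytopeGraph (⊤ : SimpleGraph (Fin h)) + convexHull ℝ (Set.range q) ∧
      w ⬝ᵥ X = M + t₀ ∧ delRead ι X = x' b := by
    intro b
    obtain ⟨y', hy', z', hz', hyz⟩ := Set.mem_add.mp (hx' b)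
    have hy'' : y' ∈ delRead ι '' (corPolytopeGraph (⊤ : SimpleGraph (Fin h)) ∩ {x | w ⬝ᵥ x = M}) := by
      rw [delRead_image_corFace ι w M hval hfree]; exact hy'
    obtain ⟨y, ⟨hyC, hyM⟩, hyy'⟩ := hy''
    have hz'' : z' ∈ delRead ι '' (convexHull ℝ (Set.range q) ∩ {y | w ⬝ᵥ y = w ⬝ᵥ q (e 0)}) := by
      rw [delRead_image_hullFace ι q w e he₁ he₂]; exact hz'
    obtain ⟨z, ⟨hzQ, hzt⟩, hzz'⟩ := hz''
    have hyM' : w ⬝ᵥ y = M := hyM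
    have hzt' : w ⬝ᵥ z = t₀ := hzt
    exact ⟨y + z, Set.add_mem_add hyC hzQ, by rw [dotProduct_add, hyM', hzt'], by rw [map_add, hyy', hzz', hyz]⟩
  choose X hXmem hXw hXread using hxlift
  -- (2) the scale λ
  set num : Finset (Fin m) → (Fin h → Bool) → Fin (K + 1) → ℝ :=
    fun a B j => c' a ⬝ᵥ delRead ι (corVec (⊤ : SimpleGraph (Fin h)) B + q j) - d' a with hnum
  set gap : (Fin h → Bool) → Fin (K + 1) → ℝ :=
    fun B j => (M - w ⬝ᵥ corVec (⊤ : SimpleGraph (Fin h)) B) + (t₀ - w ⬝ᵥ q j) with hgap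
  have hgap0 : ∀ B j, 0 ≤ gap B j := fun B j => by
    have h1 := hval B
    have h2 := he₁ 0 j
    simp only [hgap]
    linarith
  set f : Finset (Fin m) × (Fin h → Bool) × Fin (K + 1) → ℝ := fun t => max 0 (num t.1 t.2.1 t.2.2 / gap t.2.1 t.2.2) with hf
  set lam : ℝ := ∑ t, f t with hlam
  have hf0 : ∀ t, 0 ≤ f t := fun t => le_max_left _ _
  have hlam0 : 0 ≤ lam := Finset.sum_nonneg fun t _ => hf0 t
  have hlamt : ∀ a B j, num a B j ≤ lam * gap B j := by
    intro a B j
    rcases (hgap0 B j).eq_or_lt with h0 | hpos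
    · -- gap = 0: `B` is tight and `j` is a top generator, so the inner validity applies
      have hB : w ⬝ᵥ corVec (⊤ : SimpleGraph (Fin h)) B = M := by
        have h1 := hval B; have h2 := he₁ 0 j; simp only [hgap] at h0; linarith
      have hj : ∀ k, w ⬝ᵥ q k ≤ w ⬝ᵥ q j := fun k => by
        have h1 := hval B; have h2 := he₁ 0 k; simp only [hgap] at h0; linarith
      obtain ⟨j', hj'⟩ := he₂ j hj
      have hmem : delRead ι (corVec (⊤ : SimpleGraph (Fin h)) B + q j) ∈
          corPolytopeGraph (⊤ : SimpleGraph (Fin ℓ)) + convexHull ℝ (Set.range (⇑(delRead ι) ∘ q ∘ e)) := by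
        rw [map_add]
        refine Set.add_mem_add ?_ (subset_convexHull ℝ _ ⟨j', ?_⟩)
        · rw [← delRead_image_cor ι]
          exact Set.mem_image_of_mem _ (subset_convexHull ℝ _ ⟨B, rfl⟩)
        · simp only [Function.comp, hj']
      have := hval' a _ hmem
      rw [← h0, mul_zero]
      simp only [hnum]
      linarith
    · have h1 : num a B j / gap B j ≤ lam :=
        le_trans (le_max_right _ _) (Finset.single_le_sum (f := f) (fun t _ => hf0 t) (Finset.mem_univ (a, B, j)))
      rwa [div_le_iff₀ hpos] at h1
  -- (3) the lifted pattern
  refine ⟨fun a => lam • w + liftF ι (c' a), fun a => lam * (M + t₀) + d' a, X, ?_, hXmem, ?_, ?_⟩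
  · -- validity: maximise the COR part and the passenger part separately over generators, then use `hlamt` at the maximising pair
    intro a y hy
    obtain ⟨y₁, hy₁, y₂, hy₂, rfl⟩ := Set.mem_add.mp hy
    obtain ⟨B, -, hB⟩ := Finset.exists_max_image Finset.univ
      (fun B : Fin h → Bool => (lam • w + liftF ι (c' a)) ⬝ᵥ corVec (⊤ : SimpleGraph (Fin h)) B) Finset.univ_nonempty
    obtain ⟨j, -, hj⟩ := Finset.exists_max_image Finset.univ (fun j : Fin (K + 1) => (lam • w + liftF ι (c' a)) ⬝ᵥ q j)
      Finset.univ_nonempty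
    have h1 : (lam • w + liftF ι (c' a)) ⬝ᵥ y₁ ≤ (lam • w + liftF ι (c' a)) ⬝ᵥ corVec (⊤ : SimpleGraph (Fin h)) B := by
      refine XcDivision.dot_le_of_mem_convexHull _ _ _ ?_ y₁ hy₁
      rintro _ ⟨B', rfl⟩
      exact hB B' (Finset.mem_univ _)
    have h2 : (lam • w + liftF ι (c' a)) ⬝ᵥ y₂ ≤ (lam • w + liftF ι (c' a)) ⬝ᵥ q j := by
      refine XcDivision.dot_le_of_mem_convexHull _ _ _ ?_ y₂ hy₂
      rintro _ ⟨j', rfl⟩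
      exact hj j' (Finset.mem_univ _)
    have h3 := hlamt a B j
    simp only [hnum, hgap, map_add, dotProduct_add] at h3
    simp only [dotProduct_add, add_dotProduct, smul_dotProduct, liftF_dotProduct, smul_eq_mul] at h1 h2 ⊢
    linarith
  · intro a b hab
    rw [add_dotProduct, smul_dotProduct, liftF_dotProduct, smul_eq_mul, hXw, hXread, htight' a b hab]
  · intro a b hab
    rw [add_dotProduct, smul_dotProduct, liftF_dotProduct, smul_eq_mul, hXw, hXread]
    have := hdisj' a b hab
    linarith

/-- hence ★ `Face UPatF id ≤ UPat`, and in particular genus I lands in `UPat` BY NAME: -/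
theorem face_uPatF_id_le {h K : ℕ} {q : Fam h K} (hq : Face (UPatF id) h K q) : UPat h K q :=
  face_uPatF_le (s := id) monotone_id hq

/-- ★★ **`Face Quiet ≤ UPat`** — every unique-top / deletion-located / two-scale / stick-out-cube species (all `≤ Face Quiet` by parts 7–10)
is a unique-disjointness pattern of order `⌊√h⌋`, with NO exchange. -/
theorem faceQuiet_le_uPat {h K : ℕ} {q : Fam h K} (hq : Face Quiet h K q) : UPat h K q :=
  face_uPatF_id_le (face_mono (fun _ _ _ hq' => quiet_le_uPatF (s := id) (fun _ => le_rfl) hq') hq)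

/-- `Loc Quiet ≤ UPat` (quiet corners). -/
theorem locQuiet_le_uPat {h K : ℕ} {q : Fam h K} (hq : Loc Quiet h K q) : UPat h K q :=
  faceQuiet_le_uPat (loc_le_face hq)

/-- ★ `Face UPat ≤ UPat₄` (one more storey of the recursion costs only the floor). -/
theorem face_uPat_le {h K : ℕ} {q : Fam h K} (hq : Face UPat h K q) : UPatF (fun h => Nat.sqrt (Nat.sqrt h)) h K q :=
  face_uPatF_le (s := Nat.sqrt) (fun a b hab => Nat.sqrt_le_sqrt hab) hq

/-- `Face (Face Quiet) ≤ UPat₄`. -/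
theorem faceFaceQuiet_le_uPat4 {h K : ℕ} {q : Fam h K} (hq : Face (Face Quiet) h K q) :
    UPatF (fun h => Nat.sqrt (Nat.sqrt h)) h K q :=
  face_uPat_le (face_mono (fun _ _ _ => faceQuiet_le_uPat) hq)


/-- ★ HULL INVARIANCE BY NAME (§B6 functor): `Hull (UPatF s) ≤ UPatF s` — a pattern is a property of the polytope `COR(K_h) + conv q`. -/
theorem hull_uPatF_le {s : ℕ → ℕ} {h K : ℕ} {q : Fam h K} (hq : Hull (UPatF s) h K q) : UPatF s h K q := by
  obtain ⟨K', q', ⟨m, hm, hP⟩, he⟩ := hq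
  exact ⟨m, hm, uPatAt_of_hull_eq he hP⟩

/-- hence `Hull (Face Quiet) ≤ UPat`, `Hull (Face UPat) ≤ UPat₄`, … ; and ★ `AutStar UPat` is decided (`decided_autStar uPat_decided`):
the enemy clause (E-U) holds in every rooting/switching and every presentation. -/
theorem hullFaceQuiet_le_uPat {h K : ℕ} {q : Fam h K} (hq : Hull (Face Quiet) h K q) : UPat h K q :=
  hull_uPatF_le (s := Nat.sqrt) (by obtain ⟨K', q', hq', he⟩ := hq; exact ⟨K', q', faceQuiet_le_uPat hq', he⟩)

/-- `AutStar UPat` is decided (composite with part 6's `decided_autStar`). -/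
theorem autStar_uPat_decided : Decided (AutStar UPat) := decided_autStar uPat_decided

end Summit.ValiantsHypothesis.ValiantsHypothesis.Theorems.FifoMatching.Localization
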